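import Mathlib
import Summits.CriticalPhenomena.CardyFormulaZ2.Theorems.CardyMagicRigidityDefs
import Summits.CriticalPhenomena.CardyFormulaZ2.Theorems.CardyMagicRigidityPositiveConeDefs
import Summits.CriticalPhenomena.CardyFormulaZ2.Theorems.CardyMagicRigidityNestingRigidityPatternCountStability
import Literature.Probability.Percolation.NestingPhaseEstimates
import Literature.Probability.RandomPlanarGeometry.LocFinLoopConfig
import HarnessLib

/-!
# Stub S6 · `Transfer`: reduction to precompactness; reconstruction groundwork

Crux `Summit.CriticalPhenomena.CardyFormulaZ2.Theses.CardyMagicRigidity.NestingRigidity`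
(stmt-CriticalPhenomena-4835), line `ring-cloud-tomography` (r3), registered stub
`stub_transfer : Transfer`, `Transfer := NestingStatisticsAgree → LoopLimitZ2EqT`
(`Theorems/CardyMagicRigidityDefs.lean`): equality of all finite pattern-count statistics of the two
lattice ensembles forces `d_CN(bond-ℤ²_δ, site-𝕋_δ) → 0`.  The intended proof is (i) `d_CN`-precompactness
of BOTH lattice families with REGULAR limits — literally the sibling line's registered stub
`stub_precompactness : Precompactness` (`Theorems/CardyMagicRigidityPositiveConeDefs.lean`), whose
missing inputs are the ℤ²-side Aizenman–Burchard tightness and the Camia–Newman limit — and (ii) along a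
doubly convergent mesh sequence, statistics + regularity ⇒ the two limits glue.  This helper file
records, sorry-free, the FORMAL part of that route in the shared vocabulary (`zEns`, `tEns`,
`patternCount`, `Regular`, `PrecompactRegular`):

* §1 `transfer_of_precompactness` (registered sub-goal) — PURE-LOGIC GLUE: `Precompactness` and the
  statistics form of tree rigidity (the sibling statement `TreeRigidity` with its a.e.-radii hypothesis
  `NestingLawAgreement` replaced by the all-radii, disjoint-disc `NestingStatisticsAgree`, written
  inline) imply `Transfer`: every mesh sequence `δₖ → 0⁺` has a sub-subsequence along which bond-`ℤ²`
  and then site-`𝕋` converge to regular laws (`Filter.tendsto_of_subseq_tendsto`, as in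
  `nestingRigidity_of_statements`).
* §2 RECONSTRUCTION GROUNDWORK at the configuration level, for the winding interiors
  `{z | W(u, z) ≠ 0}` of the loops of a `Regular` configuration: they are non-empty
  (`setOf_wind_ne_zero_nonempty_of_regular`: a loop with empty interior would have empty trace, by
  `Regular.boundary`), open (tree: `UnbasedLoop.isOpen_setOf_wind_ne_zero`) and hence EXHAUSTED BY THE
  RATIONAL CLOSED DISCS they contain (`eq_iUnion_rat_closedBall_of_isOpen`,
  `setOf_wind_ne_zero_eq_iUnion_rat_closedBall`); so every loop of a regular configuration surrounds a
  rational closed disc of positive radius (`exists_rat_closedBall_subset_of_regular`), is macroscopic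
  (`diam_range_pos_of_regular`, via the sibling seat's `le_diam_range_of_closedBall_subset`) and has
  finitely many ancestors in every window (`finite_loops_surrounding_of_regular`); and the INJECTIVITY
  KERNEL `eq_or_eq_reverse_of_forall_rat_closedBall_iff`: two loops of ONE regular configuration
  surrounding the same rational closed discs coincide up to time reversal (`Regular.separating`).
* §3 what the counts see: under `Regular.boundary` the trace is the frontier of the interior, so the
  closure of the interior is interior ∪ trace (`closure_setOf_wind_ne_zero_eq`), the window clause of
  `patternCount` reads on the closure (`range_subset_ball_iff_closure_subset`), and the whole counting
  predicate is a predicate of the interior (`patternClauses_iff_of_boundary`); consequently two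
  configurations with the boundary property whose loops correspond bijectively with equal interiors
  have ALL pattern counts equal (`patternCount_eq_of_interiorEquiv`).  Remark (not formalised): across
  two configurations the interior does NOT determine the unbased loop up to reversal, even under all
  five `Regular` fields — e.g. a circle traversed once versus once plus a retraced arc, or a figure-eight
  `C₁⁺C₂⁺` versus `C₁⁺C₂⁻` (same `{W ≠ 0}`, same trace, positive `udist`) — so step (ii) needs a support
  property beyond `Regular` (single-signed winding, canonical traversal); `Regular.separating` only
  separates loops WITHIN one configuration.
-/

noncomputable section

open MeasureTheory Set Filter Metric
open scoped Real Topology BigOperators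

namespace Summit.CriticalPhenomena.CardyFormulaZ2.Cruxes.NestingRigidity.RingCloudTomography

open Literature.Probability.RandomPlanarGeometry Literature.Probability.Percolation
  Literature.Probability.LatticeModels
open Summit.CriticalPhenomena.CardyFormulaZ2.Theses.CardyMagicRigidity
open Summit.CriticalPhenomena.CardyFormulaZ2.Cruxes.NestingRigidity.PositiveConeWeightDoubling

/-! ## §1 Pure-logic glue: precompactness + statistics rigidity ⇒ `Transfer` -/

/-- **Glue (registered sub-goal).**  `Precompactness` (the sibling line's STUB 5: `d_CN`-precompactness
of bond-`ℤ²` and of site-`𝕋` with regular limits on `([0,1], Leb)`) together with TREE RIGIDITY IN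
STATISTICS FORM — along every doubly convergent mesh sequence with regular limits `X`, `X'`,
`NestingStatisticsAgree` forces `d_CN(bond_{δₖ}, site_{δₖ}) → 0` — imply `Transfer`.  Proof: given
`NestingStatisticsAgree`, the conclusion `LoopLimitZ2EqT` is (by `rfl`) `d_CN(zEns_δ, tEns_δ) → 0` as
`δ → 0⁺`; by `Filter.tendsto_of_subseq_tendsto` it suffices that every mesh sequence `δₖ → 0⁺` has a
subsequence along which this holds: extract the bond-`ℤ²` subsequence, then the site-`𝕋`
sub-subsequence, and apply the rigidity hypothesis along it. -/
theorem transfer_of_precompactness : Precompactness →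
    (∀ (δs : ℕ → ℝ) (X X' : unitInterval → LoopConfig ℂ), Tendsto δs atTop (𝓝[>] (0 : ℝ)) →
      Tendsto (fun k : ℕ ↦ LoopConfig.cnLawEDist zEns.P (zEns.X (δs k)) volume X) atTop (𝓝 0) →
      Tendsto (fun k : ℕ ↦ LoopConfig.cnLawEDist tEns.P (tEns.X (δs k)) volume X') atTop (𝓝 0) →
      (∀ᵐ s : unitInterval, Regular (X s)) → (∀ᵐ s : unitInterval, Regular (X' s)) →
      NestingStatisticsAgree →
        Tendsto (fun k : ℕ ↦ LoopConfig.cnLawEDist zEns.P (zEns.X (δs k)) tEns.P (tEns.X (δs k)))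
          atTop (𝓝 0)) →
    Transfer := by
  intro h₅ h₆ hstat
  obtain ⟨hpZ, hpT⟩ := h₅
  change Tendsto (fun δ : ℝ ↦ LoopConfig.cnLawEDist zEns.P (zEns.X δ) tEns.P (tEns.X δ))
    (𝓝[>] 0) (𝓝 0)
  refine Filter.tendsto_of_subseq_tendsto fun δs hδs ↦ ?_
  obtain ⟨φ, hφ, X, hXreg, hXlim⟩ := hpZ δs hδs
  have hδs' : Tendsto (δs ∘ φ) atTop (𝓝[>] (0 : ℝ)) := hδs.comp hφ.tendsto_atTop
  obtain ⟨ψ, hψ, X', hX'reg, hX'lim⟩ := hpT (δs ∘ φ) hδs'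
  have hδs'' : Tendsto (δs ∘ φ ∘ ψ) atTop (𝓝[>] (0 : ℝ)) := hδs'.comp hψ.tendsto_atTop
  have hXlim' : Tendsto (fun k : ℕ ↦ LoopConfig.cnLawEDist zEns.P (zEns.X ((δs ∘ φ ∘ ψ) k))
      volume X) atTop (𝓝 0) := hXlim.comp hψ.tendsto_atTop
  exact ⟨φ ∘ ψ, h₆ (δs ∘ φ ∘ ψ) X X' hδs'' hXlim' hX'lim hXreg hX'reg hstat⟩

/-! ## §2 Interiors of the loops of a regular configuration -/

/-- **The interior of a loop of a regular configuration is non-empty**: otherwise its trace, the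
frontier of the (empty) interior (`Regular.boundary`), would be empty, but traces of loops are not
(`UnbasedLoop.range_nonempty`). -/
theorem setOf_wind_ne_zero_nonempty_of_regular {c : LoopConfig ℂ} (hc : Regular c) {u : UnbasedLoop ℂ}
    (hu : u ∈ c.loops) : {z | u.wind z ≠ 0}.Nonempty := by
  by_contra h
  rw [Set.not_nonempty_iff_eq_empty] at h
  have hb := hc.boundary u hu
  rw [h, frontier_empty] at hb
  exact u.range_nonempty.ne_empty hb

/-- **Rational closed discs form a base inside every open set of the plane**: a point of an open set
`G` lies in a closed disc with rational centre and positive rational radius contained in `G`. -/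
theorem exists_rat_closedBall_of_isOpen {G : Set ℂ} (hG : IsOpen G) {z : ℂ} (hz : z ∈ G) :
    ∃ (q : ℚ × ℚ) (s : ℚ), 0 < s ∧ z ∈ closedBall (⟨q.1, q.2⟩ : ℂ) s ∧
      closedBall (⟨q.1, q.2⟩ : ℂ) s ⊆ G := by
  obtain ⟨ε, hε, hball⟩ := Metric.isOpen_iff.1 hG z hz
  obtain ⟨q₁, hq₁, hq₁'⟩ := exists_rat_btwn (show z.re - ε / 4 < z.re + ε / 4 by linarith)
  obtain ⟨q₂, hq₂, hq₂'⟩ := exists_rat_btwn (show z.im - ε / 4 < z.im + ε / 4 by linarith)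
  set w : ℂ := ⟨q₁, q₂⟩ with hw
  have hd : dist z w < ε / 2 := by
    rw [dist_eq_norm]
    refine (Complex.norm_le_abs_re_add_abs_im _).trans_lt ?_
    have h1 : |(z - w).re| < ε / 4 := by
      rw [Complex.sub_re, abs_lt]; simp only [hw]; constructor <;> linarith
    have h2 : |(z - w).im| < ε / 4 := by
      rw [Complex.sub_im, abs_lt]; simp only [hw]; constructor <;> linarith
    linarith
  obtain ⟨s, hs, hs'⟩ := exists_rat_btwn (show dist z w < ε - dist z w by linarith)
  have hs0 : (0 : ℝ) < s := dist_nonneg.trans_lt hs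
  refine ⟨(q₁, q₂), s, by exact_mod_cast hs0, mem_closedBall.2 hs.le, fun y hy ↦ hball ?_⟩
  rw [mem_closedBall] at hy
  rw [mem_ball]
  calc dist y z ≤ dist y w + dist z w := by rw [dist_comm z w]; exact dist_triangle y w z
    _ < ε := by linarith

/-- **An open set of the plane is the union of the rational closed discs (positive rational radius) it
contains.** -/
theorem eq_iUnion_rat_closedBall_of_isOpen {G : Set ℂ} (hG : IsOpen G) :
    G = ⋃ (q : ℚ × ℚ) (s : ℚ) (_ : 0 < s) (_ : closedBall (⟨q.1, q.2⟩ : ℂ) s ⊆ G),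
      closedBall (⟨q.1, q.2⟩ : ℂ) s := by
  refine Set.Subset.antisymm (fun z hz ↦ ?_) ?_
  · obtain ⟨q, s, hs, hzmem, hsub⟩ := exists_rat_closedBall_of_isOpen hG hz
    simp only [Set.mem_iUnion]
    exact ⟨q, s, hs, hsub, hzmem⟩
  · simp only [Set.iUnion_subset_iff]
    exact fun _ _ _ hsub ↦ hsub

/-- **Exhaustion of the winding interior by rational closed discs**: `{W(u, ·) ≠ 0}` is open (the
winding number is locally constant off the compact trace and vanishes on it,
`UnbasedLoop.isOpen_setOf_wind_ne_zero`), hence the union of the rational closed discs of positive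
rational radius it contains. -/
theorem setOf_wind_ne_zero_eq_iUnion_rat_closedBall (u : UnbasedLoop ℂ) :
    {z | u.wind z ≠ 0} = ⋃ (q : ℚ × ℚ) (s : ℚ) (_ : 0 < s)
      (_ : closedBall (⟨q.1, q.2⟩ : ℂ) s ⊆ {z | u.wind z ≠ 0}), closedBall (⟨q.1, q.2⟩ : ℂ) s :=
  eq_iUnion_rat_closedBall_of_isOpen u.isOpen_setOf_wind_ne_zero

/-- **Every loop of a regular configuration surrounds a rational closed disc of positive radius.** -/
theorem exists_rat_closedBall_subset_of_regular {c : LoopConfig ℂ} (hc : Regular c)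
    {u : UnbasedLoop ℂ} (hu : u ∈ c.loops) :
    ∃ (q : ℚ × ℚ) (s : ℚ), 0 < s ∧ closedBall (⟨q.1, q.2⟩ : ℂ) s ⊆ {z | u.wind z ≠ 0} := by
  obtain ⟨z, hz⟩ := setOf_wind_ne_zero_nonempty_of_regular hc hu
  obtain ⟨q, s, hs, -, hsub⟩ := exists_rat_closedBall_of_isOpen u.isOpen_setOf_wind_ne_zero hz
  exact ⟨q, s, hs, hsub⟩

/-- **Loops of a regular configuration are macroscopic**: their traces have positive diameter (a loop
surrounding a closed disc of radius `s` has trace diameter `≥ s`, the sibling seat's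
`le_diam_range_of_closedBall_subset`).  In particular a regular configuration has no point loops. -/
theorem diam_range_pos_of_regular {c : LoopConfig ℂ} (hc : Regular c) {u : UnbasedLoop ℂ}
    (hu : u ∈ c.loops) : 0 < diam u.range := by
  obtain ⟨q, s, hs, hsub⟩ := exists_rat_closedBall_subset_of_regular hc hu
  exact (Rat.cast_pos.2 hs).trans_le (le_diam_range_of_closedBall_subset hsub)

/-- **Finitely many ancestors in every window**: in a regular configuration, the loops with trace in
the window `B(0, R)` whose interior contains the interior of a given loop `u` form a finite set — they
all surround one rational closed disc of positive radius `s` inside the interior of `u`, hence have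
diameter `≥ s`, and `Regular.locallyFinite` allows only finitely many such loops of each type. -/
theorem finite_loops_surrounding_of_regular {c : LoopConfig ℂ} (hc : Regular c) {u : UnbasedLoop ℂ}
    (hu : u ∈ c.loops) (R : ℝ) :
    {v ∈ c.loops | v.range ⊆ ball (0 : ℂ) R ∧ {z | u.wind z ≠ 0} ⊆ {z | v.wind z ≠ 0}}.Finite := by
  obtain ⟨q, s, hs, hsub⟩ := exists_rat_closedBall_subset_of_regular hc hu
  have hs' : (0 : ℝ) < s := Rat.cast_pos.2 hs
  refine ((hc.locallyFinite 0 R s hs').union (hc.locallyFinite 1 R s hs')).subset fun v hv ↦ ?_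
  obtain ⟨hvl, hvr, hvu⟩ := hv
  have hd : (s : ℝ) ≤ diam v.range := le_diam_range_of_closedBall_subset (hsub.trans hvu)
  rcases LoopConfig.mem_loops_iff.1 hvl with h | h
  · exact Or.inl ⟨h, hvr, hd⟩
  · exact Or.inr ⟨h, hvr, hd⟩

/-- **The nesting order is read off the rational discs**: if every rational closed disc (positive
rational radius) surrounded by `u` is surrounded by `v`, then the interior of `u` lies in the interior
of `v` (no regularity needed: interiors are open). -/
theorem setOf_wind_ne_zero_subset_of_forall_rat_closedBall {u v : UnbasedLoop ℂ}
    (h : ∀ (q : ℚ × ℚ) (s : ℚ), 0 < s → closedBall (⟨q.1, q.2⟩ : ℂ) s ⊆ {z | u.wind z ≠ 0} →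
      closedBall (⟨q.1, q.2⟩ : ℂ) s ⊆ {z | v.wind z ≠ 0}) :
    {z | u.wind z ≠ 0} ⊆ {z | v.wind z ≠ 0} := by
  intro z hz
  obtain ⟨q, s, hs, hzmem, hsub⟩ := exists_rat_closedBall_of_isOpen u.isOpen_setOf_wind_ne_zero hz
  exact h q s hs hsub hzmem

/-- Two loops surrounding the same rational closed discs have the same interior. -/
theorem setOf_wind_ne_zero_eq_of_forall_rat_closedBall_iff {u v : UnbasedLoop ℂ}
    (h : ∀ (q : ℚ × ℚ) (s : ℚ), 0 < s → (closedBall (⟨q.1, q.2⟩ : ℂ) s ⊆ {z | u.wind z ≠ 0} ↔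
      closedBall (⟨q.1, q.2⟩ : ℂ) s ⊆ {z | v.wind z ≠ 0})) :
    {z | u.wind z ≠ 0} = {z | v.wind z ≠ 0} :=
  Set.Subset.antisymm (setOf_wind_ne_zero_subset_of_forall_rat_closedBall fun q s hs ↦ (h q s hs).1)
    (setOf_wind_ne_zero_subset_of_forall_rat_closedBall fun q s hs ↦ (h q s hs).2)

/-- **Injectivity kernel (within one regular configuration).**  Two loops of a regular configuration
that surround exactly the same rational closed discs of positive rational radius are equal up to time
reversal: their interiors coincide (`setOf_wind_ne_zero_eq_of_forall_rat_closedBall_iff`) and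
`Regular.separating` applies.  (Across two configurations this fails; see the module docstring.) -/
theorem eq_or_eq_reverse_of_forall_rat_closedBall_iff {c : LoopConfig ℂ} :
    Regular c → ∀ {u v : UnbasedLoop ℂ}, u ∈ c.loops → v ∈ c.loops →
      (∀ (q : ℚ × ℚ) (s : ℚ), 0 < s → (closedBall (⟨q.1, q.2⟩ : ℂ) s ⊆ {z | u.wind z ≠ 0} ↔
        closedBall (⟨q.1, q.2⟩ : ℂ) s ⊆ {z | v.wind z ≠ 0})) → u = v ∨ u = v.reverse :=
  fun hc u v hu hv h ↦ hc.separating u hu v hv (setOf_wind_ne_zero_eq_of_forall_rat_closedBall_iff h)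

/-! ## §3 What the pattern counts see: the interior (under `Regular.boundary`) -/

/-- The interior of a loop lies in every ball containing its trace (the loop winds around no point
outside such a ball, `unbasedLoop_wind_eq_zero_of_subset_ball`). -/
theorem setOf_wind_ne_zero_subset_ball_of_range_subset (u : UnbasedLoop ℂ) {w : ℂ} {ρ : ℝ}
    (h : u.range ⊆ ball w ρ) : {z | u.wind z ≠ 0} ⊆ ball w ρ := by
  intro z hz
  by_contra hzw
  rw [mem_ball, not_lt] at hzw
  exact hz (unbasedLoop_wind_eq_zero_of_subset_ball u h hzw)

/-- Under the boundary property `trace = frontier (interior)`, the closure of the (open) interior is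
interior ∪ trace. -/
theorem closure_setOf_wind_ne_zero_eq (u : UnbasedLoop ℂ) (hb : u.range = frontier {z | u.wind z ≠ 0}) :
    closure {z | u.wind z ≠ 0} = {z | u.wind z ≠ 0} ∪ u.range := by
  rw [hb, closure_eq_self_union_frontier]

/-- **The window clause reads on the closure of the interior**: under the boundary property,
`trace ⊆ B(w, ρ)` iff `closure (interior) ⊆ B(w, ρ)`. -/
theorem range_subset_ball_iff_closure_subset (u : UnbasedLoop ℂ)
    (hb : u.range = frontier {z | u.wind z ≠ 0}) (w : ℂ) (ρ : ℝ) :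
    u.range ⊆ ball w ρ ↔ closure {z | u.wind z ≠ 0} ⊆ ball w ρ := by
  rw [closure_setOf_wind_ne_zero_eq u hb, Set.union_subset_iff]
  exact ⟨fun h ↦ ⟨setOf_wind_ne_zero_subset_ball_of_range_subset u h, h⟩, fun h ↦ h.2⟩

/-- **The counting predicate of `patternCount` is a predicate of the interior** (under the boundary
property): trace in the window ⟺ closure of the interior in the window; a disc is avoided by interior
and trace ⟺ it misses the closure of the interior. -/
theorem patternClauses_iff_of_boundary (u : UnbasedLoop ℂ) (hb : u.range = frontier {z | u.wind z ≠ 0})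
    {n : ℕ} (x : Fin n → ℂ) (r : Fin n → ℝ) (R : ℝ) (S : Finset (Fin n)) :
    (u.range ⊆ ball (0 : ℂ) R ∧ (∀ i ∈ S, closedBall (x i) (r i) ⊆ {w | u.wind w ≠ 0}) ∧
        ∀ i, i ∉ S → Disjoint (closedBall (x i) (r i)) ({w | u.wind w ≠ 0} ∪ u.range)) ↔
      (closure {w | u.wind w ≠ 0} ⊆ ball (0 : ℂ) R ∧
        (∀ i ∈ S, closedBall (x i) (r i) ⊆ {w | u.wind w ≠ 0}) ∧
        ∀ i, i ∉ S → Disjoint (closedBall (x i) (r i)) (closure {w | u.wind w ≠ 0})) := by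
  rw [range_subset_ball_iff_closure_subset u hb, closure_setOf_wind_ne_zero_eq u hb]

/-- Under the boundary property on both sides, loops with equal interiors have equal traces. -/
theorem range_eq_of_setOf_wind_ne_zero_eq {u v : UnbasedLoop ℂ}
    (hu : u.range = frontier {z | u.wind z ≠ 0}) (hv : v.range = frontier {z | v.wind z ≠ 0})
    (h : {z | u.wind z ≠ 0} = {z | v.wind z ≠ 0}) : u.range = v.range := by
  rw [hu, hv, h]

/-- **Pattern counts are blind to everything but the interiors.**  If the loops of two configurations
with the boundary property (e.g. two `Regular` configurations) correspond under a bijection preserving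
winding interiors, then ALL their pattern counts coincide — every disc family, window and index set.
(So nesting-tree statistics determine at most the law of the multiset of interiors; reconstructing the
configuration up to `d_CN` from it needs injectivity of `u ↦ {W(u, ·) ≠ 0}` on the support, which
`Regular` provides only within one configuration, `eq_or_eq_reverse_of_forall_rat_closedBall_iff`.) -/
theorem patternCount_eq_of_interiorEquiv {c c' : LoopConfig ℂ}
    (hc : ∀ u ∈ c.loops, u.range = frontier {z | u.wind z ≠ 0})
    (hc' : ∀ u ∈ c'.loops, u.range = frontier {z | u.wind z ≠ 0})
    (e : c.loops ≃ c'.loops)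
    (he : ∀ u : c.loops, {z | (e u : UnbasedLoop ℂ).wind z ≠ 0} = {z | (u : UnbasedLoop ℂ).wind z ≠ 0})
    {n : ℕ} (x : Fin n → ℂ) (r : Fin n → ℝ) (R : ℝ) (S : Finset (Fin n)) :
    patternCount c x r R S = patternCount c' x r R S := by
  unfold patternCount
  -- traces agree too, by the boundary property on both sides
  have hrange : ∀ u : c.loops, (e u : UnbasedLoop ℂ).range = (u : UnbasedLoop ℂ).range := fun u ↦
    range_eq_of_setOf_wind_ne_zero_eq (hc' _ (e u).2) (hc _ u.2) (he u)
  refine Set.ncard_congr (fun u hu ↦ (e ⟨u, hu.1⟩ : UnbasedLoop ℂ)) (fun u hu ↦ ?_)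
    (fun u v hu hv huv ↦ ?_) (fun v hv ↦ ?_)
  · refine ⟨(e ⟨u, hu.1⟩).2, ?_⟩
    rw [hrange ⟨u, hu.1⟩, he ⟨u, hu.1⟩]
    exact hu.2
  · have := e.injective (Subtype.ext huv)
    simpa using this
  · refine ⟨(e.symm ⟨v, hv.1⟩ : UnbasedLoop ℂ), ⟨(e.symm ⟨v, hv.1⟩).2, ?_⟩, ?_⟩
    · have h1 := hrange (e.symm ⟨v, hv.1⟩)
      have h2 := he (e.symm ⟨v, hv.1⟩)
      rw [Equiv.apply_symm_apply] at h1 h2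
      rw [← h1, ← h2]
      exact hv.2
    · simp

end Summit.CriticalPhenomena.CardyFormulaZ2.Cruxes.NestingRigidity.RingCloudTomography

end
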